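import Summits.QuantumFields.GaugeBoot.DiagonalRPTorusPolymerBound
import HarnessLib

/-!
# Columns, ladders and one-link cuts on `(ℤ/L)³` (gauge-boot, task L3(ν), 3/4)

HONEST FRAMING (cell `pub-gaugeboot`, page 1 of every file): the venture produces certified bounds
on lattice expectations at stated coupling, gauge group, dimension and torus size; NOT a mass gap,
NOT a continuum limit, NOT a string tension; NOT Yang–Mills-summit-bearing (barriers
`FixedCouplingUltralocality`, `PerturbativeInvisibility`). This module is geometric bookkeeping
for the structural NEGATIVE result `DiagonalRPTorusNegativeOdd` (and its even-torus companion);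
it discharges nothing by itself.

## Content (general torus size `L`, dimension `3`, spectator direction `2`)

* `vsite A z` — the site at height `z` over the column `A ∈ (ℤ/L)²`; `bump a A` — the column one
  step away in the horizontal direction `a`; `sum_ite_vsite_eq` — counting a vertical family of
  links against a given link;
* `ladder B pl` — the `L` plaquettes of the vertical coordinate plane `pl = (a, 2)` based over the
  column `B`; **`ladder_boundary`**: its mod-2 boundary is `column B + column (B + e_a)`
  (feeds the lower bound `DiagRPThree.pow_mul_ksum_le`);
* **`two_mul_le_card`**: if two columns differ in BOTH coordinates, every plaquette set with
  boundary `column A + column B` has at least `2L` plaquettes — the `2L` column links are one-link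
  cuts, each separating the columns (`odd_ccnt_of_mem_colLinks`), no two in a common plaquette
  (`eq_of_mem_colLinks_of_pcnt_ne_zero`: the two vertical links of a plaquette sit over adjacent
  columns, `vertical_link`, `not_adjacent_cols`), and `DiagRPThree.card_le_of_cuts` applies
  (feeds the upper bound `DiagRPThree.ksum_le_polymer`).

Elementary; not in print as far as the cell's searches go.
-/

open MeasureTheory Complex Finset
open scoped ComplexOrder

namespace Summit.QuantumFields.GaugeBoot

open Literature.MathematicalPhysics.QuantumFieldTheory

namespace DiagRPThree

/-! ## Vertical sites, columns and ladders on `(ℤ/L)³` (general `L`) -/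

section Geometry

variable {L : ℕ}

/-- The site `(A.1, A.2, z)` at height `z` over the column `A`. -/
def vsite (A : ZMod L × ZMod L) (z : ZMod L) : Site 3 L := ![A.1, A.2, z]

/-- First coordinate of a vertical site. -/
@[simp] theorem vsite_zero (A : ZMod L × ZMod L) (z : ZMod L) : vsite A z 0 = A.1 := rfl
/-- Second coordinate of a vertical site. -/
@[simp] theorem vsite_one (A : ZMod L × ZMod L) (z : ZMod L) : vsite A z 1 = A.2 := rfl
/-- Height of a vertical site. -/
@[simp] theorem vsite_two (A : ZMod L × ZMod L) (z : ZMod L) : vsite A z 2 = z := rfl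

/-- A site is `vsite A z` iff its column is `A` and its height is `z`. -/
theorem eq_vsite_iff {y : Site 3 L} {A : ZMod L × ZMod L} {z : ZMod L} :
    y = vsite A z ↔ (y 0 = A.1 ∧ y 1 = A.2) ∧ y 2 = z := by
  constructor
  · rintro rfl
    exact ⟨⟨rfl, rfl⟩, rfl⟩
  · rintro ⟨⟨h0, h1⟩, h2⟩
    funext i
    fin_cases i
    · exact h0
    · exact h1
    · exact h2

/-- The column reached from `A` by one step in the horizontal direction `a` (`a = 2`: no move). -/
def bump (a : Fin 3) (A : ZMod L × ZMod L) : ZMod L × ZMod L :=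
  (A.1 + if a = 0 then 1 else 0, A.2 + if a = 1 then 1 else 0)

/-- Horizontal shifts move the column. -/
theorem vsite_shift_of_ne_two (A : ZMod L × ZMod L) (z : ZMod L) {a : Fin 3} (ha : a ≠ 2) :
    (vsite A z).shift a = vsite (bump a A) z := by
  funext i
  unfold bump
  fin_cases a
  · fin_cases i
    · simp [vsite]
    · simp [WilsonRP.shift_apply_of_ne _ (show (1 : Fin 3) ≠ 0 by decide), vsite]
    · simp [WilsonRP.shift_apply_of_ne _ (show (2 : Fin 3) ≠ 0 by decide), vsite]
  · fin_cases i
    · simp [WilsonRP.shift_apply_of_ne _ (show (0 : Fin 3) ≠ 1 by decide), vsite]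
    · simp [vsite]
    · simp [WilsonRP.shift_apply_of_ne _ (show (2 : Fin 3) ≠ 1 by decide), vsite]
  · exact absurd rfl ha

/-- The vertical shift moves the height. -/
theorem vsite_shift_two (A : ZMod L × ZMod L) (z : ZMod L) :
    (vsite A z).shift 2 = vsite A (z + 1) := by
  funext i
  fin_cases i
  · simp [WilsonRP.shift_apply_of_ne _ (show (0 : Fin 3) ≠ 2 by decide), vsite]
  · simp [WilsonRP.shift_apply_of_ne _ (show (1 : Fin 3) ≠ 2 by decide), vsite]
  · simp [vsite]

variable [NeZero L]

/-- **Counting a vertical family against a link**: among the links `(vsite A (z + c), k₀)`,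
`z ∈ ℤ/L`, exactly one equals `e` if `e` has direction `k₀` and column `A`, none otherwise. -/
theorem sum_ite_vsite_eq (A : ZMod L × ZMod L) (k₀ : Fin 3) (c : ZMod L) (e : Edge 3 L) :
    ∑ z : ZMod L, (if (vsite A (z + c), k₀) = e then 1 else 0) =
      if e.2 = k₀ ∧ e.1 0 = A.1 ∧ e.1 1 = A.2 then 1 else 0 := by
  have key : ∀ z : ZMod L, (vsite A (z + c), k₀) = e ↔
      (e.2 = k₀ ∧ e.1 0 = A.1 ∧ e.1 1 = A.2) ∧ z = e.1 2 - c := by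
    intro z
    rw [Prod.ext_iff, eq_comm, eq_vsite_iff]
    simp only
    constructor
    · rintro ⟨⟨⟨h0, h1⟩, h2⟩, hk⟩
      exact ⟨⟨hk.symm, h0, h1⟩, by rw [h2, add_sub_cancel_right]⟩
    · rintro ⟨⟨hk, h0, h1⟩, hz⟩
      exact ⟨⟨⟨h0, h1⟩, by rw [hz, sub_add_cancel]⟩, hk.symm⟩
  simp_rw [key]
  by_cases hP : e.2 = k₀ ∧ e.1 0 = A.1 ∧ e.1 1 = A.2
  · simp only [hP, true_and, if_true]
    rw [sum_ite_eq' univ (e.1 2 - c) (fun _ => (1 : ℕ))]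
    simp
  · simp only [hP, false_and, if_false, sum_const_zero]

/-- The vertical coordinate plane `(0, 2)`. -/
def plane02 : {q : Fin 3 × Fin 3 // q.1 < q.2} := ⟨(0, 2), by decide⟩

/-- The vertical coordinate plane `(1, 2)`. -/
def plane12 : {q : Fin 3 × Fin 3 // q.1 < q.2} := ⟨(1, 2), by decide⟩

/-- The ladder of plaquettes in the coordinate plane `pl` based at the sites over the column `B`. -/
def ladder (B : ZMod L × ZMod L) (pl : {q : Fin 3 × Fin 3 // q.1 < q.2}) :
    Finset (Plaquette 3 L) :=
  univ.image fun z : ZMod L => (vsite B z, pl)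

/-- A ladder has at most `L` plaquettes. -/
theorem card_ladder_le (B : ZMod L × ZMod L) (pl : {q : Fin 3 × Fin 3 // q.1 < q.2}) :
    (ladder B pl).card ≤ L := by
  unfold ladder
  refine card_image_le.trans ?_
  rw [card_univ, ZMod.card]

/-- **Boundary of a vertical ladder.** For a vertical plane `pl = (a, 2)`, the ladder over `B`
has mod-2 boundary `column B + column (B + e_a)`. -/
theorem ladder_boundary (B : ZMod L × ZMod L) (pl : {q : Fin 3 × Fin 3 // q.1 < q.2})
    (hpl : pl.1.2 = 2) (e : Edge 3 L) :
    Even (degS (ladder B pl) e + ccnt B e + ccnt (bump pl.1.1 B) e) := by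
  have ha : pl.1.1 ≠ 2 := fun h => by
    have := pl.2
    rw [h, hpl] at this
    exact lt_irrefl _ this
  have hinj : Function.Injective fun z : ZMod L => ((vsite B z, pl) : Plaquette 3 L) := by
    intro z z' h
    have := congrArg (fun p : Plaquette 3 L => p.1 2) h
    simpa using this
  have hdeg : degS (ladder B pl) e = ∑ z : ZMod L, pcnt (vsite B z, pl) e := by
    unfold degS ladder
    rw [sum_image fun z _ z' _ h => hinj h]
  have hexp : ∀ z : ZMod L, pcnt (vsite B z, pl) e =
      (if (vsite B (z + 0), pl.1.1) = e then 1 else 0) +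
      (if (vsite (bump pl.1.1 B) (z + 0), (2 : Fin 3)) = e then 1 else 0) +
      (if (vsite B (z + 1), pl.1.1) = e then 1 else 0) +
      (if (vsite B (z + 0), (2 : Fin 3)) = e then 1 else 0) := by
    intro z
    unfold pcnt
    simp only [add_zero, hpl, vsite_shift_of_ne_two B z ha, vsite_shift_two]
  rw [hdeg]
  simp_rw [hexp]
  rw [sum_add_distrib, sum_add_distrib, sum_add_distrib, sum_ite_vsite_eq, sum_ite_vsite_eq,
    sum_ite_vsite_eq, sum_ite_vsite_eq]
  unfold ccnt bump
  simp only
  split_ifs <;> simp_all <;> decide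

/-! ## Two columns differing in both coordinates: `2L` disjoint one-link cuts -/

omit [NeZero L] in
/-- The two vertical links of a plaquette are based at horizontally adjacent sites. -/
theorem vertical_link {p : Plaquette 3 L} {y : Site 3 L} (h : pcnt p (y, 2) ≠ 0) :
    y = p.1 ∨ y = p.1.shift p.2.1.1 := by
  have hi : p.2.1.1 ≠ 2 := fun h2 => by
    have h' := p.2.2
    rw [h2] at h'
    exact absurd h' (not_lt.2 (Fin.le_last _))
  have hmem := mem_linkList_of_pcnt_ne_zero h
  unfold linkList at hmem
  simp only [List.mem_cons, List.not_mem_nil, or_false, Prod.mk.injEq] at hmem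
  rcases hmem with ⟨h1, h2⟩ | ⟨h1, _⟩ | ⟨_, h2⟩ | ⟨h1, _⟩
  · exact absurd h2.symm hi
  · exact Or.inr h1
  · exact absurd h2.symm hi
  · exact Or.inl h1

/-- A column link lies over its column: direction `2`, column coordinates. -/
theorem col_of_mem_union {A B : ZMod L × ZMod L} {k : Edge 3 L}
    (hk : k ∈ colLinks A ∪ colLinks B) :
    k.2 = 2 ∧ ((k.1 0 = A.1 ∧ k.1 1 = A.2) ∨ (k.1 0 = B.1 ∧ k.1 1 = B.2)) := by
  rcases mem_union.1 hk with hk | hk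
  · obtain ⟨h2, h0, h1⟩ := ccnt_ne_zero (mem_colLinks.1 hk)
    exact ⟨h2, Or.inl ⟨h0, h1⟩⟩
  · obtain ⟨h2, h0, h1⟩ := ccnt_ne_zero (mem_colLinks.1 hk)
    exact ⟨h2, Or.inr ⟨h0, h1⟩⟩

omit [NeZero L] in
/-- **Column conflict.** If the columns `A`, `B` differ in both coordinates, two horizontally
adjacent sites cannot both lie over `A` or `B`. -/
theorem not_adjacent_cols {A B : ZMod L × ZMod L} (h0 : A.1 ≠ B.1) (h1 : A.2 ≠ B.2)
    {y : Site 3 L} {a : Fin 3} (ha : a = 0 ∨ a = 1)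
    (hy : (y 0 = A.1 ∧ y 1 = A.2) ∨ (y 0 = B.1 ∧ y 1 = B.2))
    (hy' : ((y.shift a) 0 = A.1 ∧ (y.shift a) 1 = A.2) ∨
      ((y.shift a) 0 = B.1 ∧ (y.shift a) 1 = B.2)) : False := by
  -- in `ℤ/1` everything is equal, so `A.1 ≠ B.1` already excludes `1 = 0`
  have hone : (1 : ZMod L) ≠ 0 := fun h10 => by
    haveI := subsingleton_of_zero_eq_one h10.symm
    exact h0 (Subsingleton.elim _ _)
  rcases ha with rfl | rfl
  · have hs0 : (y.shift 0) 0 = y 0 + 1 := WilsonRP.shift_apply_self y 0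
    have hs1 : (y.shift 0) 1 = y 1 := WilsonRP.shift_apply_of_ne y (by decide)
    rw [hs0, hs1] at hy'
    rcases hy with ⟨hA0, hA1⟩ | ⟨hB0, hB1⟩ <;> rcases hy' with ⟨hA0', hA1'⟩ | ⟨hB0', hB1'⟩
    · exact hone (by rw [hA0] at hA0'; exact add_eq_left.1 hA0')
    · exact h1 (hA1.symm.trans hB1')
    · exact h1 (hA1'.symm.trans hB1)
    · exact hone (by rw [hB0] at hB0'; exact add_eq_left.1 hB0')
  · have hs0 : (y.shift 1) 0 = y 0 := WilsonRP.shift_apply_of_ne y (by decide)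
    have hs1 : (y.shift 1) 1 = y 1 + 1 := WilsonRP.shift_apply_self y 1
    rw [hs0, hs1] at hy'
    rcases hy with ⟨hA0, hA1⟩ | ⟨hB0, hB1⟩ <;> rcases hy' with ⟨hA0', hA1'⟩ | ⟨hB0', hB1'⟩
    · exact hone (by rw [hA1] at hA1'; exact add_eq_left.1 hA1')
    · exact h0 (hA0.symm.trans hB0')
    · exact h0 (hA0'.symm.trans hB0)
    · exact hone (by rw [hB1] at hB1'; exact add_eq_left.1 hB1')

/-- **Two column links never share a plaquette** when the columns differ in both coordinates:
the two vertical links of a plaquette sit over ADJACENT columns. -/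
theorem eq_of_mem_colLinks_of_pcnt_ne_zero {A B : ZMod L × ZMod L} (h0 : A.1 ≠ B.1)
    (h1 : A.2 ≠ B.2) {p : Plaquette 3 L} {k₁ k₂ : Edge 3 L}
    (hk₁ : k₁ ∈ colLinks A ∪ colLinks B) (hk₂ : k₂ ∈ colLinks A ∪ colLinks B)
    (hp₁ : pcnt p k₁ ≠ 0) (hp₂ : pcnt p k₂ ≠ 0) : k₁ = k₂ := by
  by_contra hne
  obtain ⟨h₁2, hc₁⟩ := col_of_mem_union hk₁
  obtain ⟨h₂2, hc₂⟩ := col_of_mem_union hk₂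
  have hk₁e : k₁ = (k₁.1, (2 : Fin 3)) := Prod.ext rfl h₁2
  have hk₂e : k₂ = (k₂.1, (2 : Fin 3)) := Prod.ext rfl h₂2
  rw [hk₁e] at hp₁
  rw [hk₂e] at hp₂
  have ha : p.2.1.1 = 0 ∨ p.2.1.1 = 1 := by
    have hlt : (p.2.1.1 : ℕ) < p.2.1.2 := Fin.lt_def.1 p.2.2
    have h3 : (p.2.1.2 : ℕ) < 3 := p.2.1.2.isLt
    rw [Fin.ext_iff, Fin.ext_iff, Fin.val_zero, Fin.val_one]
    omega
  rcases vertical_link hp₁ with hy₁ | hy₁ <;> rcases vertical_link hp₂ with hy₂ | hy₂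
  · exact hne (by rw [hk₁e, hk₂e, hy₁, hy₂])
  · rw [hy₁] at hc₁
    rw [hy₂] at hc₂
    exact not_adjacent_cols h0 h1 ha hc₁ hc₂
  · rw [hy₁] at hc₁
    rw [hy₂] at hc₂
    exact not_adjacent_cols h0 h1 ha hc₂ hc₁
  · exact hne (by rw [hk₁e, hk₂e, hy₁, hy₂])

/-- **Each column link separates** two distinct columns: it lies over exactly one of them. -/
theorem odd_ccnt_of_mem_colLinks {A B : ZMod L × ZMod L} (h0 : A.1 ≠ B.1) {k : Edge 3 L}
    (hk : k ∈ colLinks A ∪ colLinks B) : Odd (ccnt A k + ccnt B k) := by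
  obtain ⟨h2, hcol⟩ := col_of_mem_union hk
  unfold ccnt
  rcases hcol with ⟨hk0, hk1⟩ | ⟨hk0, hk1⟩
  · rw [if_pos ⟨h2, hk0, hk1⟩, if_neg fun h => h0 (hk0.symm.trans h.2.1)]
    exact odd_one
  · rw [if_neg fun h => h0 (h.2.1.symm.trans hk0), if_pos ⟨h2, hk0, hk1⟩]
    exact odd_one

/-- **Disjoint one-link cuts.** If the columns `A`, `B` differ in both coordinates, every surface
with boundary `column A + column B` has at least `#(colLinks A ∪ colLinks B)` (`= 2L`) plaquettes:
the column links are one-link cuts, each separating the columns, no two in a common plaquette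
(`card_le_of_cuts`). -/
theorem card_union_colLinks_le_card {A B : ZMod L × ZMod L} (h0 : A.1 ≠ B.1) (h1 : A.2 ≠ B.2)
    {S : Finset (Plaquette 3 L)} (hS : ∀ e, Even (degS S e + ccnt A e + ccnt B e)) :
    (colLinks A ∪ colLinks B).card ≤ S.card := by
  refine card_le_of_cuts (colLinks A ∪ colLinks B) (fun k => {k}) ?_ ?_ hS
  · intro k hk
    rw [sum_singleton]
    exact odd_ccnt_of_mem_colLinks h0 hk
  · intro p
    refine card_le_one.2 fun k₁ hk₁ k₂ hk₂ => ?_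
    obtain ⟨hk₁K, hk₁odd⟩ := mem_filter.1 hk₁
    obtain ⟨hk₂K, hk₂odd⟩ := mem_filter.1 hk₂
    rw [sum_singleton] at hk₁odd hk₂odd
    have hp₁ : pcnt p k₁ ≠ 0 := fun h => by rw [h] at hk₁odd; exact Nat.not_odd_zero hk₁odd
    have hp₂ : pcnt p k₂ ≠ 0 := fun h => by rw [h] at hk₂odd; exact Nat.not_odd_zero hk₂odd
    exact eq_of_mem_colLinks_of_pcnt_ne_zero h0 h1 hk₁K hk₂K hp₁ hp₂

/-- The two columns together have exactly `2L` links when they differ (somewhere). -/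
theorem card_union_colLinks {A B : ZMod L × ZMod L} (h0 : A.1 ≠ B.1) :
    (colLinks A ∪ colLinks B).card = 2 * L := by
  have hcard : ∀ C : ZMod L × ZMod L, (colLinks C).card = L := by
    intro C
    have himg : colLinks C = univ.image fun z : ZMod L => ((vsite C z, (2 : Fin 3)) : Edge 3 L) := by
      ext e
      rw [mem_colLinks, mem_image]
      constructor
      · intro he
        obtain ⟨h2, hc0, hc1⟩ := ccnt_ne_zero he
        refine ⟨e.1 2, mem_univ _, Prod.ext ?_ h2.symm⟩
        exact (eq_vsite_iff.2 ⟨⟨hc0, hc1⟩, rfl⟩).symm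
      · rintro ⟨z, -, rfl⟩
        unfold ccnt
        rw [if_pos ⟨rfl, rfl, rfl⟩]
        exact one_ne_zero
    rw [himg, card_image_of_injective _ fun z z' h => by simpa using congrArg (fun e : Edge 3 L => e.1 2) h,
      card_univ, ZMod.card]
  have hdisj : Disjoint (colLinks A) (colLinks B) := by
    rw [disjoint_left]
    intro e heA heB
    obtain ⟨-, hA0, -⟩ := ccnt_ne_zero (mem_colLinks.1 heA)
    obtain ⟨-, hB0, -⟩ := ccnt_ne_zero (mem_colLinks.1 heB)
    exact h0 (hA0.symm.trans hB0)
  rw [card_union_of_disjoint hdisj, hcard, hcard, two_mul]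

/-- **At least `2L` plaquettes** span two columns differing in both coordinates. -/
theorem two_mul_le_card {A B : ZMod L × ZMod L} (h0 : A.1 ≠ B.1) (h1 : A.2 ≠ B.2)
    {S : Finset (Plaquette 3 L)} (hS : ∀ e, Even (degS S e + ccnt A e + ccnt B e)) :
    2 * L ≤ S.card := by
  rw [← card_union_colLinks h0]
  exact card_union_colLinks_le_card h0 h1 hS

end Geometry

end DiagRPThree

end Summit.QuantumFields.GaugeBoot
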